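import Literature.NumberTheory.ConnesMoscovici2022.UVProlateMinDomainSA
import Literature.NumberTheory.ConnesMoscovici2022.UVProlateFourierTestVectors
import Literature.NumberTheory.ConnesMoscovici2022.UVProlateQuotientBasisHolds
import Literature.NumberTheory.ConnesMoscovici2022.UVProlateGreenResolvent
import HarnessLib

/-!
# Connes–Moscovici 2022, Theorem 1.6: `W_sa` is self-adjoint, `𝓛_β = dom W_min + span{β±, β̂±}`,
# and conjuncts (iii) (uniqueness) and (iv) (spectrum) for THE operator

LINE 1 — FRAMING. RH-FREE corpus literature (cell rh-crit, C1 Connes–Consani/Moscovici corpus,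
row O2 `UVProlateSpectrum`: the self-adjointness theory of the prolate wave operator
`W_λ = −∂ₓ(λ² − x²)∂ₓ + (2πλx)²` on `L²(ℝ)`; sequel material with no leaf / binder role in any route).
bears_on: LADDER-RH W-C/W-P.  WHAT THIS IS NOT: any claim about `ζ` or RH; nothing here bears on
the truth of RH.  Theorems only: 0 `def`s, 0 named facts, no `sorry`.  `CM22_thm_1_6` (the
conjunction (i)–(iv)) STAYS a named fact; this file proves conjuncts (i)-self-adjointness, (iii) and
(iv) for THE operator `W_sa` and reduces the named fact to the two commutation clauses
(i)-`𝔽_{e_ℝ}` and (ii)-`P̂_λ` (`CM22_thm_1_6_of_fourier`).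

## Source

A. Connes, H. Moscovici, *The UV prolate spectrum matches the zeros of zeta*, PNAS 119 (2022)
[bib `ConnesMoscovici2022`] = arXiv:2112.05500, §1 (= arXiv §2), Theorem 1.6 (= arXiv Thm 2.6,
held text `paper-arxiv-2112.05500` chunk p0006:L76–L79; proof L81–L114): «(i) `W_sa` is selfadjoint
and commutes with the Fourier transform. (ii) `W_sa` commutes with the projections `P_λ` and `P̂_λ`.
(iii) `W_sa` is the only selfadjoint extension of `W_min` commuting with `P_λ` and `P̂_λ`. (iv) The
spectrum of `W_sa` is discrete and unbounded on both sides.»  Proof, first lines (p0006:L81–L85):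
«(i) `W_sa` is selfadjoint by construction … (ii) … every element of `𝓛_β` is a linear combination
of an element `ξ ∈ dom W_min` and the 4 vectors `β±, β̂±`»; (iii) (L91–L93): «The domain of a
selfadjoint extension of `W_min` commuting with `P_λ` and `P̂_λ` must be contained in `dom W_max`
and also contain both `P_λ𝒮(ℝ)` and `P̂_λ𝒮(ℝ)`. Thus it must contain `𝓛_β`, and cannot be larger
due to self-adjointness.»

## What is proved (assembly of landed doors; the analysis is in the imported files)

* §1 `exists_alpha_lemma_1_5` — an explicit `α` with the four clauses of the corrected Lemma 1.5
  (`CM22_lemma_1_5_corr`): an even `ContDiffBump` cutoff times `log|λ² − x²|`.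
* §2 **`betaQuad_independent`** — the four vectors `β₊, β₋, β̂₊ = 𝓕β₊, β̂₋ = 𝓕β₋` (the tree's
  `betaPlus`, `betaMinus` of `UVProlateFourierTestVectors`, seat cc-t10) are linearly independent
  modulo `dom W_min`: read off the uniqueness clause of `CM22_lemma_1_5_corr_holds` (seat cc-t8 g3) at
  `ξ = 0`; `betaQuad_mem_prolateSASet` — they lie in `𝓛_β` (cc-t10).
* §3 **`isSelfAdjoint_prolateSA`** — Thm 1.6 (i), first clause: `W_sa` IS SELF-ADJOINT — the von
  Neumann door `isSelfAdjoint_prolateSA_of_independent_four` (seats cc-t11/cc-t14, with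
  `dom W_min ⊆ 𝓛_β` of `UVProlateMinDomainSA` and the symmetry `prolateSA_isSymmetric` of cc-t6)
  fed with §2; `CM22_thm_1_6_i_selfAdjoint` — the same in the shape of the named fact's clause.
* §4 **`prolateSADomain_eq_sup_span_beta`** — `𝓛_β = dom W_min ⊔ span{β₊, β₋, 𝓕β₊, 𝓕β₋}`
  (the first line of the printed proof of (ii)), by cc-t11's
  `prolateSADomain_eq_sup_span_of_independent`.
* §5 `betaQuad_eq_cutoff` — `β± = P_λ f±` and `𝓕β± = P̂_λ(±𝓕⁻¹ f±)` with `f± ∈ 𝒮(ℝ)` (in the tree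
  `P̂_λ = 𝓕⁻¹ P_λ 𝓕`); hence **`CM22_thm_1_6_iii`** — conjunct (iii) AS TYPED, for every `W` with
  `IsProlateSA λ W`, via cc-t11's `CM22_thm_1_6_iii_of_struct` («must contain `P_λ𝒮(ℝ)` and
  `P̂_λ𝒮(ℝ)`, thus `𝓛_β`; cannot be larger due to self-adjointness»).
* §6 **`hasDiscreteSpectrum_prolateSA`** / `CM22_thm_1_6_iv` — conjunct (iv) unconditionally (cc-t15's
  compact-resolvent road `hasDiscreteSpectrumUnboundedBothSides_prolateSA` needs only (i)-SA).
* §7 `CM22_thm_1_6_of_fourier` — the named fact `CM22_thm_1_6` from the two remaining inputs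
  `CommutesWith (prolateSA λ) fourierL2` and `CommutesWith (prolateSA λ) (cutoffProjHat λ)`
  (seat cc-t10, `UVProlateFourierInvariance`).

Nothing in this file bears on the truth of RH.
-/

noncomputable section

open Complex Set MeasureTheory Filter SchwartzMap FourierTransform
open scoped Real Topology InnerProductSpace
open _root_.LinearPMap Literature.Analysis.UnboundedOperators

namespace Literature.NumberTheory.ConnesMoscovici2022

open Literature.NumberTheory.ConnesConsani2021 Literature.NumberTheory.ConnesConsani2024

variable {lam : ℝ}

/-! ## §1. An explicit `α` for the corrected Lemma 1.5 -/

/-- RH-FREE (PROVED). The corrected `α`-clauses of Lemma 1.5 are satisfiable: with `χ` a smooth bump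
equal to `1` on `[¾λ, ⁵⁄₄λ]` and supported in `(½λ, ³⁄₂λ)`, the even function
`α(x) = (χ(x) + χ(−x))·log|λ² − x²|` is smooth off `±λ`, even, equals `log|λ² − x²|` on `[¾λ, ⁵⁄₄λ]`
and vanishes for `x ≥ 0` outside `(½λ, ³⁄₂λ)` ("Let `α₊ ∈ C_c^∞(ℝ)` be an even function such that
`α(x) = log((λ² − x²)²)^{1/2}` for `x ∈ [¾λ, ⁵⁄₄λ]` whose support is contained in `(½λ, ³⁄₂λ)`" — read
with the smoothness off `±λ` of the tree's `CM22_lemma_1_5_corr`).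
[cite: ConnesMoscovici2022, Lemma 1.5, sentence before it (= arXiv:2112.05500 Lemma 2.5, chunk p0005:L84–L88)] -/
theorem exists_alpha_lemma_1_5 (hlam : 0 < lam) :
    ∃ α : ℝ → ℝ, ContDiffOn ℝ (⊤ : ℕ∞) α {x | x ≠ lam ∧ x ≠ -lam} ∧ (∀ x, α (-x) = α x) ∧
      (∀ x ∈ Icc (3 / 4 * lam) (5 / 4 * lam), α x = Real.log |lam ^ 2 - x ^ 2|) ∧
      (∀ x, 0 ≤ x → α x ≠ 0 → x ∈ Ioo (lam / 2) (3 / 2 * lam)) := by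
  let χ : ContDiffBump (lam : ℝ) := ⟨lam / 4, lam / 2, by positivity, by linarith⟩
  have hrIn : χ.rIn = lam / 4 := rfl
  have hrOut : χ.rOut = lam / 2 := rfl
  -- `χ(−x) = 0` for `x ≥ 0`
  have hneg : ∀ x : ℝ, 0 ≤ x → χ (-x) = 0 := fun x hx ↦ by
    refine χ.zero_of_le_dist ?_
    rw [hrOut, Real.dist_eq, show -x - lam = -(x + lam) by ring, abs_neg,
      abs_of_nonneg (by linarith)]
    linarith
  refine ⟨fun x ↦ (χ x + χ (-x)) * Real.log |lam ^ 2 - x ^ 2|, ?_, ?_, ?_, ?_⟩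
  · have hχ : ContDiff ℝ (⊤ : ℕ∞) (fun x : ℝ ↦ χ x + χ (-x)) :=
      χ.contDiff.add (χ.contDiff.comp contDiff_neg)
    exact hχ.contDiffOn.mul (contDiffOn_log_abs_pSq lam)
  · intro x
    simp only [neg_neg]
    rw [neg_sq]
    ring
  · intro x hx
    have h1 : χ x = 1 := χ.one_of_mem_closedBall (by
      rw [Metric.mem_closedBall, hrIn, Real.dist_eq, abs_le]
      constructor <;> linarith [hx.1, hx.2])
    have h2 : χ (-x) = 0 := hneg x (by linarith [hx.1])
    simp only [h1, h2, add_zero, one_mul]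
  · intro x hx0 hne
    have h2 : χ (-x) = 0 := hneg x hx0
    have h1 : χ x ≠ 0 := by
      intro h
      apply hne
      simp only [h, h2, add_zero, zero_mul]
    have hmem : x ∈ Function.support (χ : ℝ → ℝ) := h1
    rw [χ.support_eq, Metric.mem_ball, hrOut, Real.dist_eq, abs_lt] at hmem
    constructor <;> linarith [hmem.1, hmem.2]

/-! ## §2. The four boundary vectors `β₊, β₋, 𝓕β₊, 𝓕β₋` are independent modulo `dom W_min` -/

/-- RH-FREE (PROVED). **The four vectors `β₊ = 1_I`, `β₋ = x·1_I`, `β̂₊ = 𝓕β₊`, `β̂₋ = 𝓕β₋` are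
linearly independent modulo `dom W_min`** — a sub-family of the basis `{α±, β±, α̂±, β̂±}` of
`ℰ = dom W_max / dom W_min` of Lemma 1.5: read off the uniqueness clause of the tree theorem
`CM22_lemma_1_5_corr_holds` at `ξ = 0` (coefficient vector supported on the four `β`-slots).
[cite: ConnesMoscovici2022, Lemma 1.5 and Thm 1.6 proof «the 4 vectors β±, β̂±» (= arXiv:2112.05500 Lemma 2.5, chunk p0005:L84–L104; p0006:L83–L85)] -/
theorem betaQuad_independent (hlam : 0 < lam) (c : Fin 4 → ℂ)
    (hc : (∑ k, c k • (![betaPlus lam hlam, betaMinus lam hlam, (𝓕 (betaPlus lam hlam) : L2R),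
      (𝓕 (betaMinus lam hlam) : L2R)] : Fin 4 → L2R) k) ∈ (prolateMin lam).domain) :
    c = 0 := by
  obtain ⟨α, hαU, heven, hlog, hsupp⟩ := exists_alpha_lemma_1_5 hlam
  have hga := memLp_alpha hlam hαU heven hlog hsupp
  have hgm := memLp_alphaMinus hlam hαU heven hlog hsupp
  have h15 := CM22_lemma_1_5_corr_holds lam hlam α hαU heven hlog hsupp (hga.toLp _) (hgm.toLp _)
    (betaPlus lam hlam) (betaMinus lam hlam) hga.coeFn_toLp hgm.coeFn_toLp
    (betaPlus_coeFn hlam) (betaMinus_coeFn hlam)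
  have h0 := h15.2 0 (Submodule.zero_mem _)
  -- the extended coefficient vector on the eight slots `(α₊, α₋, β₊, β₋, α̂₊, α̂₋, β̂₊, β̂₋)`
  let C : Fin 8 → ℂ := ![0, 0, c 0, c 1, 0, 0, c 2, c 3]
  have hC0 : C = 0 := by
    refine h0.unique ?_ ?_
    · have hsum : ∑ i, C i • (![hga.toLp _, hgm.toLp _, betaPlus lam hlam, betaMinus lam hlam,
          fourierL2 (hga.toLp _), fourierL2 (hgm.toLp _), fourierL2 (betaPlus lam hlam),
          fourierL2 (betaMinus lam hlam)] : Fin 8 → L2R) i =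
          ∑ k, c k • (![betaPlus lam hlam, betaMinus lam hlam, (𝓕 (betaPlus lam hlam) : L2R),
            (𝓕 (betaMinus lam hlam) : L2R)] : Fin 4 → L2R) k := by
        simp [Fin.sum_univ_succ, C, fourierL2]
      rw [hsum, zero_sub]
      exact Submodule.neg_mem _ hc
    · simp
  funext k
  fin_cases k
  · exact congr_fun hC0 2
  · exact congr_fun hC0 3
  · exact congr_fun hC0 6
  · exact congr_fun hC0 7

/-- RH-FREE (PROVED). The four vectors `β₊, β₋, 𝓕β₊, 𝓕β₋` lie in `𝓛_β = dom W_sa` (seat cc-t10's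
`betaPlus_mem_prolateSASet`, `betaMinus_mem_prolateSASet`, `fourier_betaPlus_mem_prolateSASet`,
`fourier_betaMinus_mem_prolateSASet`, packaged on `Fin 4`).
[cite: ConnesMoscovici2022, Thm 1.6 proof «every element of 𝓛_β is a linear combination of an element ξ ∈ dom W_min and the 4 vectors β±, β̂±» (= arXiv:2112.05500 chunk p0006:L83–L85)] -/
theorem betaQuad_mem_prolateSASet (hlam : 0 < lam) :
    ∀ i, (![betaPlus lam hlam, betaMinus lam hlam, (𝓕 (betaPlus lam hlam) : L2R),
      (𝓕 (betaMinus lam hlam) : L2R)] : Fin 4 → L2R) i ∈ prolateSASet lam := by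
  intro i
  fin_cases i
  · exact betaPlus_mem_prolateSASet hlam
  · exact betaMinus_mem_prolateSASet hlam
  · exact fourier_betaPlus_mem_prolateSASet hlam
  · exact fourier_betaMinus_mem_prolateSASet hlam

/-! ## §3. Theorem 1.6 (i): `W_sa` is self-adjoint -/

/-- RH-FREE (PROVED). **Theorem 1.6 (i), first clause: `W_sa` is self-adjoint** — for THE operator
`prolateSA λ` (the restriction of `W_max` to `𝓛_β`): von Neumann's extension theory with deficiency
indices `(4,4)` (Lemma 1.1), `W_min ⊂ W_sa` (`dom W_min ⊆ 𝓛_β`), the symmetry of `W_sa` and four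
elements `β±, β̂±` of `𝓛_β` independent modulo `dom W_min` (doors of seats cc-t11/cc-t14/cc-t6/cc-t10,
§2 above). («(i) `W_sa` is selfadjoint by construction», «one checks directly that they are both
selfadjoint» for `W_sa^±`.)
[cite: ConnesMoscovici2022, Thm 1.6 (i) (= arXiv:2112.05500 Thm 2.6 (i), chunk p0006:L76–L81, L86–L90); EdmundsEvans2018, Ch. III §4 Thm 4.8] -/
theorem isSelfAdjoint_prolateSA (hlam : 0 < lam) : IsSelfAdjoint (prolateSA lam hlam) :=
  isSelfAdjoint_prolateSA_of_independent_four hlam _ (betaQuad_mem_prolateSASet hlam)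
    (betaQuad_independent hlam)

/-- RH-FREE (PROVED). Thm 1.6 (i), self-adjointness, for any `W` satisfying the printed definition of
`W_sa` (`IsProlateSA λ W`, which forces `W = prolateSA λ`).
[cite: ConnesMoscovici2022, Thm 1.6 (i) (= arXiv:2112.05500 Thm 2.6 (i), chunk p0006:L76–L81)] -/
theorem IsProlateSA.isSelfAdjoint (hlam : 0 < lam) {W : L2R →ₗ.[ℂ] L2R} (hW : IsProlateSA lam W) :
    IsSelfAdjoint W := by
  rw [hW.eq_prolateSA hlam]
  exact isSelfAdjoint_prolateSA hlam

/-- RH-FREE (PROVED). **Conjunct (i)-self-adjointness of `CM22_thm_1_6`, in the shape of the named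
fact's clause.** [cite: ConnesMoscovici2022, Thm 1.6 (i) (= arXiv:2112.05500 Thm 2.6 (i), chunk p0006:L76–L81)] -/
theorem CM22_thm_1_6_i_selfAdjoint :
    ∀ lam : ℝ, 0 < lam → ∀ W : L2R →ₗ.[ℂ] L2R, IsProlateSA lam W → IsSelfAdjoint W :=
  fun _ hlam _ hW ↦ hW.isSelfAdjoint hlam

/-! ## §4. `𝓛_β = dom W_min + span{β₊, β₋, β̂₊, β̂₋}` -/

/-- RH-FREE (PROVED). **«Every element of `𝓛_β` is a linear combination of an element
`ξ ∈ dom W_min` and the 4 vectors `β±, β̂±`»** — and conversely: `𝓛_β = dom W_min ⊔ span{β₊, β₋,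
𝓕β₊, 𝓕β₋}` as submodules of `L²(ℝ)` (cc-t11's `prolateSADomain_eq_sup_span_of_independent` with
`dom W_min ⊆ 𝓛_β`, the symmetry of `W_sa` and §2).
[cite: ConnesMoscovici2022, Thm 1.6, proof of (ii), first sentence (= arXiv:2112.05500 chunk p0006:L83–L85)] -/
theorem prolateSADomain_eq_sup_span_beta (hlam : 0 < lam) :
    prolateSADomain lam hlam = (prolateMin lam).domain ⊔ Submodule.span ℂ
      (Set.range (![betaPlus lam hlam, betaMinus lam hlam, (𝓕 (betaPlus lam hlam) : L2R),
        (𝓕 (betaMinus lam hlam) : L2R)] : Fin 4 → L2R)) :=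
  prolateSADomain_eq_sup_span_of_independent hlam (prolateMin_domain_le_prolateSADomain hlam)
    (prolateSA_isSymmetric hlam) _ (betaQuad_mem_prolateSASet hlam) (betaQuad_independent hlam)

/-- RH-FREE (PROVED). The same for the carrier set `prolateSASet λ = 𝓛_β`: membership form.
[cite: ConnesMoscovici2022, Thm 1.6, proof of (ii), first sentence (= arXiv:2112.05500 chunk p0006:L83–L85)] -/
theorem mem_prolateSASet_iff_exists_add_sum (hlam : 0 < lam) (ξ : L2R) :
    ξ ∈ prolateSASet lam ↔ ∃ η ∈ (prolateMin lam).domain, ∃ c : Fin 4 → ℂ,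
      ξ = η + ∑ k, c k • (![betaPlus lam hlam, betaMinus lam hlam, (𝓕 (betaPlus lam hlam) : L2R),
        (𝓕 (betaMinus lam hlam) : L2R)] : Fin 4 → L2R) k := by
  rw [← mem_prolateSADomain hlam, prolateSADomain_eq_sup_span_beta hlam, Submodule.mem_sup]
  constructor
  · rintro ⟨η, hη, z, hz, rfl⟩
    obtain ⟨c, rfl⟩ := (Submodule.mem_span_range_iff_exists_fun ℂ).1 hz
    exact ⟨η, hη, c, rfl⟩
  · rintro ⟨η, hη, c, rfl⟩
    exact ⟨η, hη, _, (Submodule.mem_span_range_iff_exists_fun ℂ).2 ⟨c, rfl⟩, rfl⟩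

/-! ## §5. Theorem 1.6 (iii): uniqueness among self-adjoint extensions commuting with `P_λ, P̂_λ` -/

/-- `𝓕 (𝓕⁻¹ f) = f` through the embedding `𝒮(ℝ) ⊂ L²(ℝ)`. [folklore] -/
private theorem fourier_schwartzToL2_fourierInv (φ : 𝓢(ℝ, ℂ)) :
    (𝓕 (schwartzToL2 (𝓕⁻ φ)) : L2R) = schwartzToL2 φ := by
  change (𝓕 ((𝓕⁻ φ).toLp 2 volume) : L2R) = φ.toLp 2 volume
  rw [SchwartzMap.toLp_fourier_eq, fourier_fourierInv_eq]

/-- RH-FREE (PROVED). **`β± ∈ P_λ𝒮(ℝ)` and `β̂± ∈ P̂_λ𝒮(ℝ)`**: `β₊ = P_λ f₊`, `β₋ = P_λ f₋` (by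
definition, `f± ∈ 𝒮(ℝ)` the tree's `testBump`, `testBumpX`) and, since the tree's `P̂_λ` is
`𝓕⁻¹ P_λ 𝓕` and `𝓕β₊ = 𝓕⁻¹β₊`, `𝓕β₋ = −𝓕⁻¹β₋` (parity), `𝓕β₊ = P̂_λ(𝓕⁻¹ f₊)` and
`𝓕β₋ = P̂_λ(−𝓕⁻¹ f₋)` with `𝓕⁻¹ f± ∈ 𝒮(ℝ)` («`β₊ … belongs to P_λ𝒮(ℝ)`»; «must … contain both
`P_λ𝒮(ℝ)` and `P̂_λ𝒮(ℝ)`»).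
[cite: ConnesMoscovici2022, Lemma 1.5 setup and Thm 1.6 proof of (iii) (= arXiv:2112.05500 chunk p0005:L86; p0006:L91–L93)] -/
theorem betaQuad_eq_cutoff (hlam : 0 < lam) :
    ∀ i, ∃ f ∈ (prolateCore lam).domain,
      (![betaPlus lam hlam, betaMinus lam hlam, (𝓕 (betaPlus lam hlam) : L2R),
        (𝓕 (betaMinus lam hlam) : L2R)] : Fin 4 → L2R) i = cutoffProj lam f ∨
      (![betaPlus lam hlam, betaMinus lam hlam, (𝓕 (betaPlus lam hlam) : L2R),
        (𝓕 (betaMinus lam hlam) : L2R)] : Fin 4 → L2R) i = cutoffProjHat lam f := by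
  intro i
  fin_cases i
  · exact ⟨schwartzToL2 (testBump lam hlam), LinearMap.mem_range_self _ _, Or.inl rfl⟩
  · exact ⟨schwartzToL2 (testBumpX lam hlam), LinearMap.mem_range_self _ _, Or.inl rfl⟩
  · refine ⟨schwartzToL2 (𝓕⁻ (testBump lam hlam)), LinearMap.mem_range_self _ _, Or.inr ?_⟩
    show (𝓕 (betaPlus lam hlam) : L2R) = cutoffProjHat lam (schwartzToL2 (𝓕⁻ (testBump lam hlam)))
    rw [cutoffProjHat_apply, fourier_schwartzToL2_fourierInv, ← fourierInv_betaPlus hlam]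
    rfl
  · refine ⟨-schwartzToL2 (𝓕⁻ (testBumpX lam hlam)),
      Submodule.neg_mem _ (LinearMap.mem_range_self _ _), Or.inr ?_⟩
    show (𝓕 (betaMinus lam hlam) : L2R) =
      cutoffProjHat lam (-schwartzToL2 (𝓕⁻ (testBumpX lam hlam)))
    rw [_root_.map_neg, cutoffProjHat_apply, fourier_schwartzToL2_fourierInv]
    change _ = -(𝓕⁻ (betaMinus lam hlam) : L2R)
    rw [fourierInv_betaMinus hlam, neg_neg]

/-- RH-FREE (PROVED). **Theorem 1.6 (iii)** AS TYPED in `CM22_thm_1_6`: for every `W` satisfying the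
printed definition of `W_sa`, `W` is the only self-adjoint extension of `W_min` commuting with `P_λ`
and `P̂_λ` — «the domain of a selfadjoint extension of `W_min` commuting with `P_λ` and `P̂_λ` must
… contain both `P_λ𝒮(ℝ)` and `P̂_λ𝒮(ℝ)`. Thus it must contain `𝓛_β`» (§4–§5 with cc-t11's
`prolateSASet_subset_domain_of_commutesWith`), «and cannot be larger due to self-adjointness» (§3 and
the maximality of self-adjoint operators, `IsProlateSA.eq_of_isSelfAdjoint_of_subset`).
[cite: ConnesMoscovici2022, Thm 1.6 (iii) and its proof (= arXiv:2112.05500 Thm 2.6 (iii), chunk p0006:L76–L79, L91–L93)] -/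
theorem CM22_thm_1_6_iii :
    ∀ lam : ℝ, 0 < lam → ∀ W : L2R →ₗ.[ℂ] L2R, IsProlateSA lam W →
      ∀ W' : L2R →ₗ.[ℂ] L2R, IsSelfAdjoint W' → prolateMin lam ≤ W' →
        CommutesWith W' (cutoffProj lam) → CommutesWith W' (cutoffProjHat lam) → W' = W :=
  fun _ hlam _ hW ↦ CM22_thm_1_6_iii_of_struct hlam (isSelfAdjoint_prolateSA hlam) _
    (prolateSADomain_eq_sup_span_beta hlam) (betaQuad_eq_cutoff hlam) hW

/-- RH-FREE (PROVED). In particular every self-adjoint extension `W'` of `W_min` commuting with `P_λ`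
and `P̂_λ` IS `prolateSA λ`. [cite: ConnesMoscovici2022, Thm 1.6 (iii) (= arXiv:2112.05500 Thm 2.6 (iii), chunk p0006:L76–L79, L91–L93)] -/
theorem eq_prolateSA_of_isSelfAdjoint_of_commutesWith (hlam : 0 < lam) {W' : L2R →ₗ.[ℂ] L2R}
    (hW' : IsSelfAdjoint W') (hmin : prolateMin lam ≤ W') (hP : CommutesWith W' (cutoffProj lam))
    (hPhat : CommutesWith W' (cutoffProjHat lam)) : W' = prolateSA lam hlam :=
  CM22_thm_1_6_iii lam hlam _ (isProlateSA_prolateSA hlam) W' hW' hmin hP hPhat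

/-! ## §6. Theorem 1.6 (iv): the spectrum of `W_sa` is discrete and unbounded on both sides -/

/-- RH-FREE (PROVED). **Theorem 1.6 (iv)** for THE operator: `W_sa` has an orthonormal eigenbasis
with real eigenvalues `μ_n`, `|μ_n| → ∞`, bounded neither above nor below (cc-t15's compact-resolvent
road `hasDiscreteSpectrumUnboundedBothSides_prolateSA`, whose only input is (i)-self-adjointness, §3).
[cite: ConnesMoscovici2022, Thm 1.6 (iv) and its proof (= arXiv:2112.05500 Thm 2.6 (iv), chunk p0006:L76–L79, L94–L114)] -/
theorem hasDiscreteSpectrum_prolateSA (hlam : 0 < lam) :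
    HasDiscreteSpectrumUnboundedBothSides (prolateSA lam hlam) :=
  hasDiscreteSpectrumUnboundedBothSides_prolateSA hlam (isSelfAdjoint_prolateSA hlam)

/-- RH-FREE (PROVED). **Conjunct (iv) of `CM22_thm_1_6`, in the shape of the named fact's clause.**
[cite: ConnesMoscovici2022, Thm 1.6 (iv) (= arXiv:2112.05500 Thm 2.6 (iv), chunk p0006:L76–L79, L94–L114)] -/
theorem CM22_thm_1_6_iv :
    ∀ lam : ℝ, 0 < lam → ∀ W : L2R →ₗ.[ℂ] L2R, IsProlateSA lam W →
      HasDiscreteSpectrumUnboundedBothSides W := by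
  intro lam hlam W hW
  rw [hW.eq_prolateSA hlam]
  exact hasDiscreteSpectrum_prolateSA hlam

/-! ## §7. `CM22_thm_1_6` reduced to the two commutation clauses -/

/-- RH-FREE (PROVED). **The named fact `CM22_thm_1_6` from its two remaining inputs**: the
commutation of `W_sa` with the Fourier transform (clause (i), second half) and with `P̂_λ` (clause
(ii), second half; the `P_λ` half is the tree's `CM22_thm_1_6_ii_cutoffProj`).  Self-adjointness (§3),
uniqueness (iii) (§5, via the structure of `𝓛_β`, §4) and the spectral clause (iv) (§6) are supplied
here.  `CM22_thm_1_6` itself stays a named fact until those two commutation theorems land.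
[cite: ConnesMoscovici2022, Thm 1.6 (i)–(iv) (= arXiv:2112.05500 Thm 2.6, chunk p0006:L76–L79; proof L81–L114)] -/
theorem CM22_thm_1_6_of_fourier
    (hF : ∀ (lam : ℝ) (hlam : 0 < lam), CommutesWith (prolateSA lam hlam) fourierL2)
    (hPhat : ∀ (lam : ℝ) (hlam : 0 < lam), CommutesWith (prolateSA lam hlam) (cutoffProjHat lam)) :
    CM22_thm_1_6 :=
  CM22_thm_1_6_of_struct (fun _ hlam ↦ isSelfAdjoint_prolateSA hlam) hF hPhat
    (fun _ hlam ↦ ⟨_, prolateSADomain_eq_sup_span_beta hlam, betaQuad_eq_cutoff hlam⟩)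
    (fun _ hlam ↦ hasDiscreteSpectrum_prolateSA hlam)

end Literature.NumberTheory.ConnesMoscovici2022

end
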